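import Mathlib
import Literature.Analysis.FluidPDE.SereginSverak2002CaseB
import Literature.Analysis.FluidPDE.SereginSverakPressure
import Summits.NavierStokesRegularity.NavierStokesRegularity.Theses.HiddenConvexityPressureFloor
import HarnessLib

/-!
# `HiddenConvexityPressureFloor.SereginSverakFloorExtension` — Seregin–Šverák 2002 under a
  pressure floor, in the Clay class (item stmt-NavierStokesRegularity-2963)

**Statement.** `ν > 0`, `T > 0`, `(u, p)` classical on `ℝ³ × [0, T)`, Leray–Hopf on `[0, T]` from
its rapidly decaying datum `u 0`; if the normalised pressure is bounded below on `[0, T) × ℝ³`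
(`∃ M, ∀ t < T, ∀ x, -M ≤ p̃[u(t)](x)`), then `u` extends as a classical solution past `T`.

PROOF. The pressure-floor half of Seregin–Šverák's theorem is an UNCONDITIONAL theorem of the tree,
`Literature.Analysis.FluidPDE.seregin_sverak_2002_of_floor` (`SereginSverak2002CaseB.lean`; the
floor on `(0, T)` gives boundedness of `u` on `(δ, T) × ℝ³` for every `δ ∈ (0, T)` — unlike the
head-ceiling half, no final-time hypothesis is needed). Continuation is then the pattern of
`seregin_sverak_2002.hasSmoothExtensionPast_of_continuation`: restart at an energy-good time
`s ∈ (0, T)` (`IsLerayHopfOn.exists_isLerayHopfOn_translate`), the translate `u(· + s)` is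
classical on `[0, T - s)`, Leray–Hopf from `u s` and bounded, so it continues past `T - s` by the
discharged `hasSmoothExtensionPast_of_bounded_holds` (RRS 2016 Thm. 8.17), and the extension is glued
back by `HasSmoothExtensionPast.of_translate`.

HONEST FRAMING: a known conditional regularity criterion (Seregin–Šverák 2002, pressure bounded
below) transcribed to the tree's Clay class from accepted tree theorems; it says nothing about
whether the floor hypothesis ever holds near a putative singularity.
-/

noncomputable section

set_option linter.dupNamespace false

namespace Summit.NavierStokesRegularity.NavierStokesRegularity.Theorems

open MeasureTheory Set Metric Filter Topology Literature.Analysis.FluidPDE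

/-- **Continuation under a pressure floor on `(0, T)`** (Seregin–Šverák 2002, case `p̃ ≥ -K`,
continuation form): a classical solution on `[0, T) × ℝ³`, Leray–Hopf on `[0, T]` from a rapidly
decaying datum, with `-K ≤ p̃[u(t)](x)` for `t ∈ (0, T)`, extends as a classical solution past `T`.
[cite: SereginSverak2002, Thm. 2.2 (p. 70), case (2.10)] -/
theorem hasSmoothExtensionPast_of_pressureFloor_Ioo {ν T : ℝ} (hν : 0 < ν) (hT : 0 < T)
    {u : ℝ → EuclideanSpace ℝ (Fin 3) → EuclideanSpace ℝ (Fin 3)}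
    {p : ℝ → EuclideanSpace ℝ (Fin 3) → ℝ}
    (hsol : IsClassicalNSSolutionOn (Ico 0 T) ν 0 u p) (hLH : IsLerayHopfOn T ν 0 (u 0) u)
    (h₀ : HasRapidSpatialDecay (u 0))
    (hfloor : ∃ K : ℝ, ∀ t ∈ Ioo 0 T, ∀ x, -K ≤ normalisedPressure (u t) x) :
    HasSmoothExtensionPast ν 0 u T := by
  have hbd : ∀ δ ∈ Ioo 0 T, ∃ M : ℝ, ∀ t ∈ Ioo δ T, ∀ x, ‖u t x‖ ≤ M :=
    seregin_sverak_2002_of_floor ν T hν hT u p hsol hLH h₀ hfloor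
  -- an energy-good restarting time `s ∈ (0, T)`
  obtain ⟨s, hs, hLHs⟩ := hLH.exists_isLerayHopfOn_translate hsol hν.le hT le_rfl
  have hs2 : s / 2 ∈ Ioo 0 T := ⟨by linarith [hs.1], by linarith [hs.2]⟩
  obtain ⟨M, hM⟩ := hbd (s / 2) hs2
  -- the translate: classical on `[0, T - s)`, Leray–Hopf from `u s`, bounded on `[0, T - s) × ℝ³`
  have hsol' : IsClassicalNSSolutionOn (Ico 0 (T - s)) ν 0 (fun t => u (t + s))
      (fun t => p (t + s)) := hsol.translate_Ico_zero hs.1.le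
  have hLHs' : IsLerayHopfOn (T - s) ν 0 ((fun t => u (t + s)) 0) (fun t => u (t + s)) := by
    show IsLerayHopfOn (T - s) ν 0 (u (0 + s)) (fun t => u (t + s))
    rw [zero_add]
    exact hLHs
  have hMs : ∃ M : ℝ, ∀ t ∈ Ico 0 (T - s), ∀ x, ‖(fun t => u (t + s)) t x‖ ≤ M :=
    ⟨M, fun t ht x => hM (t + s) ⟨by linarith [ht.1, hs.1], by linarith [ht.2]⟩ x⟩
  -- continuation of the bounded translate past `T - s`, glued back to `u`
  have hext : HasSmoothExtensionPast ν 0 (fun t => u (t + s)) (T - s) :=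
    hasSmoothExtensionPast_of_bounded_holds hν (sub_pos.2 hs.2) hsol' hLHs' hMs
  exact HasSmoothExtensionPast.of_translate hsol hs.1 hs.2 hext

/-- **Item stmt-NavierStokesRegularity-2963** (`HiddenConvexityPressureFloor.SereginSverakFloorExtension`):
Seregin–Šverák 2002 under a pressure floor on `[0, T) × ℝ³`, in the Clay class, continuation form —
by `hasSmoothExtensionPast_of_pressureFloor_Ioo` (floor restricted from `[0, T)` to `(0, T)`).
[cite: SereginSverak2002, Thm. 2.2 (p. 70), case (2.10)] -/
theorem hiddenConvexityPressureFloor_sereginSverakFloorExtension_proof :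
    Summit.NavierStokesRegularity.NavierStokesRegularity.Theses.HiddenConvexityPressureFloor.SereginSverakFloorExtension := by
  unfold Summit.NavierStokesRegularity.NavierStokesRegularity.Theses.HiddenConvexityPressureFloor.SereginSverakFloorExtension
  intro ν T hν hT u p hsol hLH h₀ hM
  obtain ⟨K, hK⟩ := hM
  exact hasSmoothExtensionPast_of_pressureFloor_Ioo hν hT hsol hLH h₀
    ⟨K, fun t ht x => hK t (Ioo_subset_Ico_self ht) x⟩

end Summit.NavierStokesRegularity.NavierStokesRegularity.Theorems

end
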